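import Summits.NavierStokesRegularity.NavierStokesRegularity.Theorems.HardyPointSinkHardyAncientLimitTypeI
import Literature.Analysis.FluidPDE.ClassicalSolutionRescale
import HarnessLib

/-!
# Route HardyPointSink — `HardyAncientLimit`, step 1b: a Hardy-bounded vertex is Type I,
# zoomed frame

Support file for item stmt-NavierStokesRegularity-9138 (`HardyAncientLimit`) of route
`HardyPointSink` (problem `NavierStokesRegularity`).

Setting (viscosity already normalised to `1`): `(u, p)` is a classical solution of the unforced
Navier–Stokes system on `[0, T) × ℝ³` which is Leray–Hopf on `[0, T]`, `xs ∈ ℝ³`, and the local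
Hardy energies near `xs` are bounded up to the final time,
`∫_{B(xs, r₀)} |u(t, x)|² / |x − x₀| dx ≤ K` for all `x₀ ∈ B(xs, r₀)` and `T − r₀² < t < T`.

Content: `HardyAncientLimit.typeIBound_zoom_lt_top` — the zoomed form of
`HardyAncientLimit.typeIBound_vertex_lt_top` (file `HardyPointSinkHardyAncientLimitTypeI`): for
the zoomed pair `u₁ = c u(T + c² s, xs + c y)`, `q₁ = c² q(T + c² s, xs + c y)` (gauged Riesz
pressure `q`), Albritton–Barker's Type I quantity of the half unit ball, computed with the
classical gradient `∇u₁`, is finite: `𝐈(Q(0, 1/2); u₁, q₁, ∇u₁) < ∞` (Albritton–Barker 2019,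
Lemma 2.6, via the tree's `albrittonBarker2019_lemma_2_6_holds`).

## References

* D. Albritton, T. Barker, J. Math. Fluid Mech. 21 (2019) = arXiv:1811.00502, Lemma 2.6.
* G. Seregin, arXiv:math/0607537 = J. Math. Sci. 143 (2007), Lemma 2.1.
* L. Caffarelli, R. Kohn, L. Nirenberg, CPAM 35 (1982), §2.
-/

noncomputable section

open Literature.Analysis.FluidPDE MeasureTheory Set Function Filter Topology Metric TopologicalSpace
open scoped ENNReal NNReal

namespace Summit.NavierStokesRegularity.NavierStokesRegularity.Theorems

namespace HardyAncientLimit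

variable {T : ℝ} {u : ℝ → (EuclideanSpace ℝ (Fin 3)) → (EuclideanSpace ℝ (Fin 3))} {p : ℝ → (EuclideanSpace ℝ (Fin 3)) → ℝ}

/-- **Type I at the vertex, in the zoomed frame.** Same hypotheses as
`typeIBound_vertex_lt_top`; conclusion for the zoomed pair
`u₁ = c u(T + c² s, xs + c y)`, `q₁ = c² q(T + c² s, xs + c y)` (the vertex ball `Q((T, xs), c)`
becomes the unit ball `Q(0, 1)`, its half the ball `Q(0, 1/2)`), with the CLASSICAL gradient
`∇u₁` of the zoomed velocity (a weak spatial gradient on `Q(0, 1)`, the zoomed velocity being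
`C¹` on `]-1, 0[ × ℝ³` as `c² ≤ T`): `𝐈(Q(0, 1/2); u₁, q₁, ∇u₁) < ∞`. This is the form consumed by
the blow-up around near-maximum points. -/
theorem typeIBound_zoom_lt_top (hT : 0 < T) (hsol : IsClassicalNSSolutionOn (Ico 0 T) 1 0 u p)
    (hLH : IsLerayHopfOn T 1 0 (u 0) u) {xs : (EuclideanSpace ℝ (Fin 3))} {r₀ : ℝ} {K : ℝ≥0}
    (hH : ∀ x₀ ∈ ball xs r₀, ∀ t ∈ Ico 0 T, T - r₀ ^ 2 < t →
      ∫⁻ x in ball xs r₀, ‖u t x‖ₑ ^ 2 / ‖x - x₀‖ₑ ≤ K)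
    {c : ℝ} (hc : 0 < c) (hcr : c ≤ r₀) (hcT : c ^ 2 ≤ T) :
    typeIBound (parabolicCylinder (1 / 2) (0 : ℝ × (EuclideanSpace ℝ (Fin 3))))
        (c • stPull (c ^ 2) c T xs u)
        (c ^ 2 • stPull (c ^ 2) c T xs (fun t x => p t x - (p t 0 - normalisedPressure (u t) 0)))
        (fun s y => fderiv ℝ ((c • stPull (c ^ 2) c T xs u) s) y) < ∞ := by
  set z₁ : ℝ × (EuclideanSpace ℝ (Fin 3)) := (T, xs) with hz₁
  set q : ℝ → (EuclideanSpace ℝ (Fin 3)) → ℝ := fun t x => p t x - (p t 0 - normalisedPressure (u t) 0) with hq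
  set u₁ : ℝ → (EuclideanSpace ℝ (Fin 3)) → (EuclideanSpace ℝ (Fin 3)) := c • stPull (c ^ 2) c T xs u
    with hu₁
  have hc2 : 0 < c ^ 2 := pow_pos hc 2
  -- the suitable pair in the vertex ball and its zoom to the unit ball
  have hsw : IsSuitableWeakSolutionInBall c z₁ u q :=
    SereginSverak2002.isSuitableWeakSolutionInBall_vertex hT hsol hLH xs hcT
  have hzoom := hsw.zoom hc
  -- the zoomed velocity is `C¹` on `]-1, 0[ × ℝ³`, so `∇u₁` is a weak spatial gradient on `Q(0, 1)`
  have hsm₁ : IsSmoothSpaceTimeOn (Ioo (-1 : ℝ) 0) u₁ := by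
    refine ((hsol.smooth_velocity.mono Ioo_subset_Ico_self).smul_stPull c (c ^ 2) c T xs).mono ?_
    intro s hs
    simp only [mem_preimage, mem_Ioo] at hs ⊢
    constructor <;> nlinarith [hs.1, hs.2]
  have hGz : HasWeakSpatialGradientOn (parabolicCylinderOpens 1 (0 : ℝ × (EuclideanSpace ℝ (Fin 3)))) u₁
      fun s y => fderiv ℝ (u₁ s) y := by
    have hQ : ((parabolicCylinderOpens 1 (0 : ℝ × (EuclideanSpace ℝ (Fin 3))) :
        Opens (ℝ × (EuclideanSpace ℝ (Fin 3)))) : Set (ℝ × (EuclideanSpace ℝ (Fin 3)))) ⊆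
        Ioo (-1 : ℝ) 0 ×ˢ (univ : Set (EuclideanSpace ℝ (Fin 3))) := by
      rw [coe_parabolicCylinderOpens, parabolicCylinder]
      refine prod_mono (fun t ht => ?_) (subset_univ _)
      simpa using ht
    exact hasWeakSpatialGradientOn_of_contDiffOn isOpen_Ioo hQ (hsm₁.of_le (by exact_mod_cast le_top))
  -- surjectivity of the zoom, to transport inclusions of balls
  have hsurj : Function.Surjective (stAffine (c ^ 2) c z₁.1 z₁.2) :=
    (stAffineHomeomorph (pow_ne_zero 2 hc.ne') hc.ne' z₁.1 z₁.2).surjective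
  -- `A` of the zoomed velocity is bounded by `K` on every sub-ball of the unit ball
  have hA : (⨆ (r : ℝ) (_ : 0 < r) (z' : ℝ × (EuclideanSpace ℝ (Fin 3)))
      (_ : parabolicCylinder r z' ⊆ parabolicCylinder 1 (0 : ℝ × (EuclideanSpace ℝ (Fin 3)))),
        cknAEss r z' (c • stPull (c ^ 2) c z₁.1 z₁.2 u)) < ∞ := by
    refine lt_of_le_of_lt ?_ (ENNReal.coe_lt_top (r := K))
    refine iSup_le fun r => iSup_le fun hr => iSup_le fun z' => iSup_le fun hz' => ?_
    rw [cknAEss_nsZoom hc hr]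
    refine cknAEss_le_of_hardy hc hcr hcT hH (mul_pos hc hr) ?_
    rw [← hsurj.preimage_subset_preimage_iff,
      LocalTypeIScaling.stAffine_preimage_parabolicCylinder hc z₁.1 z₁.2 r z',
      show parabolicCylinder c ((T, xs) : ℝ × (EuclideanSpace ℝ (Fin 3))) = parabolicCylinder c z₁ from rfl,
      zoom_preimage_parabolicCylinder_self hc z₁]
    exact hz'
  -- Lemma 2.6 on the unit ball, at `R = 1/2`
  exact albrittonBarker2019_lemma_2_6_holds (0 : ℝ × (EuclideanSpace ℝ (Fin 3))) _ _ hzoom _ hGz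
    (Or.inl hA) (1 / 2) (by norm_num) (by norm_num)

end HardyAncientLimit

end Summit.NavierStokesRegularity.NavierStokesRegularity.Theorems

end
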